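import Mathlib.RepresentationTheory.Homological.ContCohomology.Functoriality
import Mathlib.RepresentationTheory.Homological.ContCohomology.LowDegree
import HarnessLib

/-!
# Continuous cohomology in degree one: explicit cocycles

Generic glue (namespace `Literature`) on top of Mathlib's continuous group cohomology
(`continuousCohomology`, `ContinuousCohomology.map`; files
`Mathlib.RepresentationTheory.Homological.ContCohomology.*`), which is defined abstractly as the
homology of the complex of `G`-invariant homogeneous cochains `C(G, C(G, ⋯ C(G, X)))` in the
non-abelian category `TopModuleCat R` and comes (as of this Mathlib) with no description of `H¹`,
no long exact sequence and no element-level API. This file provides, with complete proofs: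

* `Literature.NumberTheory.GaloisRepresentations.kerToHomology`, `Literature.NumberTheory.GaloisRepresentations.cxClass`: explicit homology classes `[x]` of cycles `x` for short
  complexes / homological complexes of topological modules (via the standard `LeftHomologyData`
  `ker g`, `ker g ⧸ im f` and its comparison isomorphism with Mathlib's chosen homology object);
  surjectivity, the criterion `[x] = 0 ↔ x is a boundary`, and naturality
  `homologyMap φ [x] = [φ x]`.
* `Literature.contOneCocycles X`: continuous crossed homomorphisms `φ : G → X`
  (`φ (g h) = φ g + g • φ h`) of a topological representation `X : TopRep R G`;
  `Literature.oneCocycleClass X φ ∈ continuousCohomology 1 X`, the class of the invariant homogeneous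
  cocycle `(x, y) ↦ φ y - φ x`; it is additive/linear (`oneCocycleClassₗ`), surjective
  (`oneCocycleClass_surjective`), its kernel consists of the principal crossed homomorphisms
  `g ↦ g • v - v` (`oneCocycleClass_eq_zero_iff`), and Mathlib's functoriality map
  `ContinuousCohomology.map θ f 1` acts by `[φ] ↦ [f ∘ φ ∘ θ]` (`map_oneCocycleClass`).

This is the classical identification `H¹_cont(G, X) = Z¹_cont / B¹` of continuous cohomology
computed with homogeneous versus inhomogeneous cochains, in degree one.

Sources: Serre, *Galois Cohomology* (1997), I.§2.2 (cochains, inhomogeneous description),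
I.§2.4 (compatible pairs), I.§5.1 (`H¹` as crossed homomorphisms); Neukirch–Schmidt–Wingberg,
*Cohomology of Number Fields*, I.§2 and II.§7 (continuous cochains); Tate (1976),
*Relations between K₂ and Galois cohomology*, §2 (continuous cochain cohomology).

## Mathlib reuse

Everything categorical is Mathlib's: `ShortComplex.LeftHomologyData` (`homologyIso`, `cyclesIso`,
`π_comp_homologyIso_inv`, `f'_i`), `ShortComplex.homologyπ_naturality`, `cyclesMap_i`,
`TopModuleCat.ker/kerι/coker/cokerπ/isLimitKer/isColimitCoker`, `TopRep.d`, `d_comp_d`,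
`homogeneousCochains.d_apply`, `ContinuousCohomology.cochainsMap`, `coind₁_apply_apply`.

## Design choices

* `namespace Literature` throughout (no declaration is placed in a Mathlib namespace).
* Universes: `G H : Type v` and `X : TopRep.{v} R G` share one universe, as forced by Mathlib's
  `resolutionX` (`C(G, X)` must live in the universe of `X`) and `ContinuousCohomology.map`.
* The description is given for an arbitrary topological representation `X` (no discreteness);
  the discrete Galois-module case used by `Literature/NumberTheory/EllipticCurves` is the
  specialisation `X = Literature.discreteTopRep G M`.
-/

noncomputable section

open CategoryTheory Limits

universe u v w

namespace Literature.NumberTheory.GaloisRepresentations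

/-! ## Explicit homology classes for short complexes of topological modules -/

section ShortComplex

variable {R : Type u} [Ring R] [TopologicalSpace R]

/-- The standard left homology data of a short complex `X₁ → X₂ → X₃` of topological modules:
cycles `K = ker g` with the subspace topology and homology `H = K ⧸ im (X₁ → K)` with the quotient
topology (the data used by Mathlib's `CategoryWithHomology (TopModuleCat R)` instance).
[folklore] -/
abbrev stdLeftHomologyData (S : ShortComplex (TopModuleCat.{v} R)) : S.LeftHomologyData where
  K := TopModuleCat.ker S.g
  H := TopModuleCat.coker ((TopModuleCat.isLimitKer S.g).lift (KernelFork.ofι S.f S.zero))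
  i := TopModuleCat.kerι S.g
  π := TopModuleCat.cokerπ _
  wi := TopModuleCat.kerι_comp S.g
  hi := TopModuleCat.isLimitKer S.g
  wπ := TopModuleCat.comp_cokerπ _
  hπ := TopModuleCat.isColimitCoker _

variable (S : ShortComplex (TopModuleCat.{v} R))

/-- The homology class map `ker g → H(S)` of a short complex of topological modules, as an
`R`-linear map (composite of the quotient map `K → K ⧸ im f` with the comparison isomorphism to
Mathlib's chosen `S.homology`). [folklore] -/
def kerToHomology : S.g.hom.ker →ₗ[R] S.homology :=
  ((stdLeftHomologyData S).π ≫ (stdLeftHomologyData S).homologyIso.inv).hom.toLinearMap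

/-- Unfolding `kerToHomology`. [folklore] -/
theorem kerToHomology_apply (z : S.g.hom.ker) :
    kerToHomology S z =
      (stdLeftHomologyData S).homologyIso.inv ((stdLeftHomologyData S).π z) :=
  rfl

/-- Every homology class is the class of a cycle. [folklore] -/
theorem kerToHomology_surjective : Function.Surjective (kerToHomology S) := by
  intro c
  obtain ⟨z, hz⟩ := TopModuleCat.cokerπ_surjective _ ((stdLeftHomologyData S).homologyIso.hom c)
  refine ⟨z, ?_⟩
  rw [kerToHomology_apply]
  change (stdLeftHomologyData S).homologyIso.inv (((stdLeftHomologyData S).π).hom z) = c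
  erw [hz]
  exact Iso.hom_inv_id_apply ((stdLeftHomologyData S).homologyIso) c

/-- The comparison isomorphism is injective on carriers. [folklore] -/
theorem homologyIso_inv_injective :
    Function.Injective ((stdLeftHomologyData S).homologyIso.inv :
      (stdLeftHomologyData S).H → S.homology) := by
  intro a b hab
  have := congrArg (stdLeftHomologyData S).homologyIso.hom hab
  rwa [Iso.inv_hom_id_apply, Iso.inv_hom_id_apply] at this

/-- The induced map `X₁ → ker g` is `f` on underlying elements. [folklore] -/
theorem coe_i_f' (y : S.X₁) :
    (((stdLeftHomologyData S).f' y : (stdLeftHomologyData S).K) : S.X₂) = S.f y := by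
  change (stdLeftHomologyData S).i ((stdLeftHomologyData S).f' y) = S.f y
  rw [← CategoryTheory.comp_apply, (stdLeftHomologyData S).f'_i]

/-- A cycle has zero homology class iff it is a boundary. [folklore] -/
theorem kerToHomology_eq_zero_iff (z : S.g.hom.ker) :
    kerToHomology S z = 0 ↔ ∃ y : S.X₁, S.f y = z.1 := by
  rw [kerToHomology_apply, ← map_zero (stdLeftHomologyData S).homologyIso.inv.hom]
  change (stdLeftHomologyData S).homologyIso.inv ((stdLeftHomologyData S).π z) =
    (stdLeftHomologyData S).homologyIso.inv 0 ↔ _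
  rw [(homologyIso_inv_injective S).eq_iff]
  change (TopModuleCat.cokerπ (stdLeftHomologyData S).f').hom z = 0 ↔ _
  rw [TopModuleCat.hom_cokerπ, Submodule.mkQ_apply, Submodule.Quotient.mk_eq_zero,
    LinearMap.mem_range]
  constructor
  · rintro ⟨y, hy⟩
    exact ⟨y, (coe_i_f' S y).symm.trans (congrArg Subtype.val hy)⟩
  · rintro ⟨y, hy⟩
    exact ⟨y, Subtype.ext ((coe_i_f' S y).trans hy)⟩

/-- Mathlib's `homologyπ` on a cycle is the class of the underlying element of `X₂`. [folklore] -/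
theorem homologyπ_eq_kerToHomology (c : S.cycles) :
    S.homologyπ c = kerToHomology S ⟨S.iCycles c, by
      rw [LinearMap.mem_ker, ContinuousLinearMap.coe_coe, ← CategoryTheory.comp_apply,
        S.iCycles_g]; rfl⟩ := by
  have hc : c = (stdLeftHomologyData S).cyclesIso.inv ((stdLeftHomologyData S).cyclesIso.hom c) :=
    (Iso.hom_inv_id_apply (stdLeftHomologyData S).cyclesIso c).symm
  conv_lhs => rw [hc]
  rw [← CategoryTheory.comp_apply, ← (stdLeftHomologyData S).π_comp_homologyIso_inv,
    kerToHomology_apply, CategoryTheory.comp_apply]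
  congr 2

/-- The class of a cycle `z` is `homologyπ` of the corresponding element of Mathlib's `cycles`.
[folklore] -/
theorem kerToHomology_eq_homologyπ (z : S.g.hom.ker) :
    kerToHomology S z = S.homologyπ ((stdLeftHomologyData S).cyclesIso.inv z) := by
  rw [kerToHomology_apply, ← CategoryTheory.comp_apply, ← CategoryTheory.comp_apply,
    (stdLeftHomologyData S).π_comp_homologyIso_inv]

variable {S} in
/-- Naturality of the explicit homology class: `homologyMap φ [z] = [φ.τ₂ z]`. [folklore] -/
theorem homologyMap_kerToHomology {S' : ShortComplex (TopModuleCat.{v} R)} (φ : S ⟶ S')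
    (z : S.g.hom.ker) (z' : S'.g.hom.ker) (hz : (z' : S'.X₂) = φ.τ₂ z) :
    ShortComplex.homologyMap φ (kerToHomology S z) = kerToHomology S' z' := by
  rw [kerToHomology_eq_homologyπ, ← CategoryTheory.comp_apply, ShortComplex.homologyπ_naturality,
    CategoryTheory.comp_apply, homologyπ_eq_kerToHomology]
  congr 2
  rw [hz]
  change (ShortComplex.cyclesMap φ ≫ S'.iCycles) _ = _
  rw [ShortComplex.cyclesMap_i, CategoryTheory.comp_apply, ← CategoryTheory.comp_apply
    (stdLeftHomologyData S).cyclesIso.inv S.iCycles,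
    (stdLeftHomologyData S).cyclesIso_inv_comp_iCycles]
  rfl

end ShortComplex

/-! ## Homological complexes of topological modules -/

section HomologicalComplex

variable {R : Type u} [Ring R] [TopologicalSpace R] {ι : Type*} {c : ComplexShape ι}
variable (K : HomologicalComplex (TopModuleCat.{v} R) c)

/-- The homology class `[x] ∈ Hⁱ(K)` of an element `x ∈ Kⁱ` with `d x = 0`, for a complex of
topological modules. [folklore] -/
def cxClass (i j : ι) (hj : c.next i = j) (x : K.X i) (hx : K.d i j x = 0) : K.homology i :=
  kerToHomology (K.sc i) ⟨x, by subst hj; exact hx⟩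

variable {K} in
/-- Classes of equal cycles are equal (proof-irrelevance helper). [folklore] -/
theorem cxClass_congr {i j : ι} {hj : c.next i = j} {x x' : K.X i} {hx : K.d i j x = 0}
    {hx' : K.d i j x' = 0} (h : x = x') : cxClass K i j hj x hx = cxClass K i j hj x' hx' := by
  subst h; rfl

/-- Additivity of `cxClass`. [folklore] -/
theorem cxClass_add (i j : ι) (hj : c.next i = j) (x y : K.X i) (hx : K.d i j x = 0)
    (hy : K.d i j y = 0) :
    cxClass K i j hj (x + y) (by rw [map_add, hx, hy, add_zero]) =
      cxClass K i j hj x hx + cxClass K i j hj y hy := by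
  unfold cxClass
  exact ((kerToHomology (K.sc i)).map_add ⟨x, _⟩ ⟨y, _⟩).symm ▸ rfl

/-- `R`-linearity of `cxClass`. [folklore] -/
theorem cxClass_smul (i j : ι) (hj : c.next i = j) (r : R) (x : K.X i) (hx : K.d i j x = 0) :
    cxClass K i j hj (r • x) (by rw [map_smul, hx, smul_zero]) = r • cxClass K i j hj x hx := by
  unfold cxClass
  exact ((kerToHomology (K.sc i)).map_smul r ⟨x, _⟩).symm ▸ rfl

/-- Every class in `Hⁱ(K)` is represented by an element of `Kⁱ` killed by `d`. [folklore] -/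
theorem cxClass_surjective (i j : ι) (hj : c.next i = j) (γ : K.homology i) :
    ∃ (x : K.X i) (hx : K.d i j x = 0), cxClass K i j hj x hx = γ := by
  obtain ⟨⟨x, hx⟩, rfl⟩ := kerToHomology_surjective (K.sc i) γ
  subst hj
  exact ⟨x, hx, rfl⟩

/-- A class `[x] ∈ Hⁱ(K)` vanishes iff `x` is a boundary. [folklore] -/
theorem cxClass_eq_zero_iff (i j : ι) (hj : c.next i = j) (i₀ : ι) (hi₀ : c.prev i = i₀)
    (x : K.X i) (hx : K.d i j x = 0) :
    cxClass K i j hj x hx = 0 ↔ ∃ y : K.X i₀, K.d i₀ i y = x := by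
  subst hi₀
  exact kerToHomology_eq_zero_iff (K.sc i) _

/-- Mathlib's `homologyπ` in terms of explicit classes. [folklore] -/
theorem homologyπ_eq_cxClass (i j : ι) (hj : c.next i = j) (z : K.cycles i) :
    K.homologyπ i z = cxClass K i j hj (K.iCycles i z) (by
      rw [← CategoryTheory.comp_apply, K.iCycles_d]; rfl) := by
  subst hj
  exact homologyπ_eq_kerToHomology (K.sc i) z

variable {K} in
/-- Naturality: `H(φ) [x] = [φ x]`. [folklore] -/
theorem homologyMap_cxClass {L : HomologicalComplex (TopModuleCat.{v} R) c} (φ : K ⟶ L)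
    (i j : ι) (hj : c.next i = j) (x : K.X i) (hx : K.d i j x = 0) (x' : L.X i)
    (hx' : L.d i j x' = 0) (h : x' = φ.f i x) :
    HomologicalComplex.homologyMap φ i (cxClass K i j hj x hx) = cxClass L i j hj x' hx' :=
  homologyMap_kerToHomology ((HomologicalComplex.shortComplexFunctor _ c i).map φ) _ _ h

end HomologicalComplex

/-! ## Continuous `H¹` via crossed homomorphisms -/

section H1

open TopRep ContRepresentation ContinuousCohomology

variable {R : Type u} [Ring R] [TopologicalSpace R]
variable {G : Type v} [Group G] [TopologicalSpace G] [IsTopologicalGroup G]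
variable (X : TopRep.{v} R G)

set_option allowUnsafeReducibility true in
attribute [local reducible] CategoryTheory.Functor.mapHomologicalComplex

/-- The first differential of Mathlib's standard resolution: `(d φ)(x)(y) = φ y - φ x`.
[folklore] -/
theorem d_one_hom_apply (φ : C(G, X)) (x y : G) : (TopRep.d X 1).hom φ x y = φ y - φ x := rfl

/-- The second differential of Mathlib's standard resolution:
`(d F)(x)(y)(z) = F y z - (F x z - F x y)`. [folklore] -/
theorem d_two_hom_apply (F : C(G, C(G, X))) (x y z : G) :
    (TopRep.d X 2).hom F x y z = F y z - (F x z - F x y) := rfl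

/-- The `R`-module of continuous 1-cocycles (continuous crossed homomorphisms) of a topological
representation `X`: continuous `φ : G → X` with `φ (g h) = φ g + g • φ h`.
Serre, *Galois Cohomology*, I.§2.2 and I.§5.1; Neukirch–Schmidt–Wingberg, (1.2) and II.§7.
[folklore] -/
def contOneCocycles : Submodule R C(G, X) where
  carrier := {φ | ∀ g h, φ (g * h) = φ g + X.ρ g (φ h)}
  zero_mem' g h := by simp
  add_mem' {a b} ha hb g h := by
    simp only [ContinuousMap.add_apply, ha g h, hb g h, map_add]
    abel
  smul_mem' r a ha g h := by
    simp only [ContinuousMap.smul_apply, ha g h, smul_add, map_smul]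

omit [IsTopologicalGroup G] in
variable {X} in
/-- Membership in `contOneCocycles`: the crossed-homomorphism identity. [folklore] -/
theorem mem_contOneCocycles_iff (φ : C(G, X)) :
    φ ∈ contOneCocycles X ↔ ∀ g h, φ (g * h) = φ g + X.ρ g (φ h) :=
  Iff.rfl

omit [IsTopologicalGroup G] in
variable {X} in
/-- A crossed homomorphism vanishes at `1`. Serre, *Galois Cohomology*, I.§5.1. [folklore] -/
theorem contOneCocycles.apply_one (φ : contOneCocycles X) : φ.1 1 = 0 := by
  have h := φ.2 1 1
  have h1 : (X.ρ 1) (φ.1 1) = φ.1 1 := by rw [_root_.map_one X.ρ]; rfl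
  rw [mul_one, h1, left_eq_add] at h
  exact h

omit [IsTopologicalGroup G] in
variable {X} in
/-- `g • φ (g⁻¹ y) = φ y - φ g` for a crossed homomorphism `φ`. [folklore] -/
theorem contOneCocycles.apply_smul_inv_mul (φ : contOneCocycles X) (g y : G) :
    X.ρ g (φ.1 (g⁻¹ * y)) = φ.1 y - φ.1 g := by
  have h := φ.2 g (g⁻¹ * y)
  rw [mul_inv_cancel_left] at h
  rw [h, add_sub_cancel_left]

/-- The homogeneous 1-cochain `(x, y) ↦ φ y - φ x = d φ` attached to a continuous crossed
homomorphism `φ`; it is `G`-invariant. Serre, *Galois Cohomology*, I.§2.2 (homogeneous vs.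
inhomogeneous cochains). [folklore] -/
def toOneCochain (φ : contOneCocycles X) : (homogeneousCochains X).X 1 :=
  ⟨(TopRep.d X 1).hom φ.1, by
    rw [ContRepresentation.mem_invariants]
    intro g
    ext x y
    change X.ρ g (φ.1 (g⁻¹ * y) - φ.1 (g⁻¹ * x)) = φ.1 y - φ.1 x
    rw [map_sub, contOneCocycles.apply_smul_inv_mul, contOneCocycles.apply_smul_inv_mul]
    abel⟩

/-- Unfolding `toOneCochain`. [folklore] -/
@[simp]
theorem coe_toOneCochain (φ : contOneCocycles X) :
    ((toOneCochain X φ : (homogeneousCochains X).X 1) : C(G, C(G, X))) =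
      (TopRep.d X 1).hom φ.1 :=
  rfl

/-- Additivity of `toOneCochain`. [folklore] -/
theorem toOneCochain_add (φ ψ : contOneCocycles X) :
    toOneCochain X (φ + ψ) = toOneCochain X φ + toOneCochain X ψ :=
  Subtype.ext (map_add _ _ _)

/-- Linearity of `toOneCochain`. [folklore] -/
theorem toOneCochain_smul (r : R) (φ : contOneCocycles X) :
    toOneCochain X (r • φ) = r • toOneCochain X φ :=
  Subtype.ext (map_smul _ _ _)

/-- `(ComplexShape.up ℕ).next 1 = 2`. [folklore] -/
theorem up_nat_next_one : (ComplexShape.up ℕ).next 1 = 2 := CochainComplex.next ℕ 1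

/-- `(ComplexShape.up ℕ).prev 1 = 0`. [folklore] -/
theorem up_nat_prev_one : (ComplexShape.up ℕ).prev 1 = 0 := CochainComplex.prev_nat_succ 0

/-- `d φ` is a cocycle (`d ∘ d = 0`). [folklore] -/
theorem d_toOneCochain (φ : contOneCocycles X) :
    (homogeneousCochains X).d 1 2 (toOneCochain X φ) = 0 := by
  apply Subtype.ext
  have h := homogeneousCochains.d_apply X 1 (toOneCochain X φ)
  change (((homogeneousCochains X).d 1 2 (toOneCochain X φ) : (homogeneousCochains X).X 2) :
    C(G, C(G, C(G, X)))) = (d X 2).hom ((TopRep.d X 1).hom φ.1) at h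
  rw [h]
  have h2 := congr(($(TopRep.d_comp_d X 1)).hom φ.1)
  rw [TopRep.hom_comp, TopRep.hom_zero] at h2
  exact h2

/-- The class `[φ] ∈ H¹_cont(G, X)` of a continuous crossed homomorphism `φ` in Mathlib's
`continuousCohomology 1 X`. Serre, *Galois Cohomology*, I.§2.2. [folklore] -/
def oneCocycleClass (φ : contOneCocycles X) : continuousCohomology 1 X :=
  cxClass (homogeneousCochains X) 1 2 up_nat_next_one (toOneCochain X φ) (d_toOneCochain X φ)

/-- Additivity of `oneCocycleClass`. [folklore] -/
theorem oneCocycleClass_add (φ ψ : contOneCocycles X) :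
    oneCocycleClass X (φ + ψ) = oneCocycleClass X φ + oneCocycleClass X ψ := by
  unfold oneCocycleClass
  rw [← cxClass_add]
  exact cxClass_congr (toOneCochain_add X φ ψ)

/-- Linearity of `oneCocycleClass`. [folklore] -/
theorem oneCocycleClass_smul (r : R) (φ : contOneCocycles X) :
    oneCocycleClass X (r • φ) = r • oneCocycleClass X φ := by
  unfold oneCocycleClass
  rw [← cxClass_smul]
  exact cxClass_congr (toOneCochain_smul X r φ)

/-- The class map `Z¹_cont(G, X) → H¹_cont(G, X)` as an `R`-linear map. [folklore] -/
def oneCocycleClassₗ : contOneCocycles X →ₗ[R] continuousCohomology 1 X where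
  toFun := oneCocycleClass X
  map_add' := oneCocycleClass_add X
  map_smul' := oneCocycleClass_smul X

/-- Unfolding `oneCocycleClassₗ`. [folklore] -/
@[simp]
theorem oneCocycleClassₗ_apply (φ : contOneCocycles X) :
    oneCocycleClassₗ X φ = oneCocycleClass X φ :=
  rfl

/-- The zero cocycle has zero class. [folklore] -/
theorem oneCocycleClass_zero : oneCocycleClass X 0 = 0 :=
  (oneCocycleClassₗ X).map_zero

/-- `oneCocycleClass` respects subtraction. [folklore] -/
theorem oneCocycleClass_sub (φ ψ : contOneCocycles X) :
    oneCocycleClass X (φ - ψ) = oneCocycleClass X φ - oneCocycleClass X ψ :=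
  (oneCocycleClassₗ X).map_sub φ ψ

/-- Every class in `H¹_cont(G, X)` is represented by a continuous crossed homomorphism (the
inhomogeneous cocycle `φ = F(1, ·)` of an invariant homogeneous cocycle `F`).
Serre, *Galois Cohomology*, I.§2.2. [folklore] -/
theorem oneCocycleClass_surjective : Function.Surjective (oneCocycleClass X) := by
  intro γ
  obtain ⟨σ, hσ, rfl⟩ := cxClass_surjective (homogeneousCochains X) 1 2 up_nat_next_one γ
  have hcoc : ∀ x y z, σ.1 y z - (σ.1 x z - σ.1 x y) = 0 := by
    intro x y z
    have h := homogeneousCochains.d_apply X 1 σ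
    change (((homogeneousCochains X).d 1 2 σ : (homogeneousCochains X).X 2) :
      C(G, C(G, C(G, X)))) = (d X 2).hom σ.1 at h
    rw [hσ] at h
    have h' := congrArg (fun F : C(G, C(G, C(G, X))) => F x y z) h
    exact h'.symm
  have hinv : ∀ g x y, X.ρ g (σ.1 (g⁻¹ * x) (g⁻¹ * y)) = σ.1 x y := fun g x y => by
    have h := σ.2 g
    exact congrArg (fun F : C(G, C(G, X)) => F x y) h
  have hφ : σ.1 1 ∈ contOneCocycles X := by
    intro g h
    have h1 := hinv g g (g * h)
    rw [inv_mul_cancel, inv_mul_cancel_left] at h1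
    have h2 := hcoc 1 g (g * h)
    rw [← h1, sub_eq_zero] at h2
    rw [h2]
    abel
  refine ⟨⟨σ.1 1, hφ⟩, cxClass_congr (Subtype.ext ?_)⟩
  ext x y
  rw [coe_toOneCochain, d_one_hom_apply]
  have h := hcoc 1 x y
  rw [sub_eq_zero] at h
  exact h.symm

/-- A continuous crossed homomorphism has trivial class iff it is principal:
`[φ] = 0 ↔ ∃ v, φ g = g • v - v`. Serre, *Galois Cohomology*, I.§2.2 and I.§5.1. [folklore] -/
theorem oneCocycleClass_eq_zero_iff (φ : contOneCocycles X) :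
    oneCocycleClass X φ = 0 ↔ ∃ v : X, ∀ g, φ.1 g = X.ρ g v - v := by
  unfold oneCocycleClass
  rw [cxClass_eq_zero_iff _ 1 2 up_nat_next_one 0 up_nat_prev_one]
  constructor
  · rintro ⟨τ, hτ⟩
    refine ⟨τ.1 1, fun g => ?_⟩
    have h1 := congrArg (fun s : (homogeneousCochains X).X 1 => (s.1 : C(G, C(G, X))) 1 g) hτ
    have h0 := homogeneousCochains.d_apply X 0 τ
    change (((homogeneousCochains X).d 0 1 τ : (homogeneousCochains X).X 1) :
      C(G, C(G, X))) = (d X 1).hom τ.1 at h0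
    have h1' : ((TopRep.d X 1).hom τ.1) 1 g = ((TopRep.d X 1).hom φ.1) 1 g := by
      rw [← h0]; exact h1
    have h1'' : τ.1 g - τ.1 1 = φ.1 g - φ.1 1 := h1'
    rw [contOneCocycles.apply_one, sub_zero] at h1''
    have h2 : X.ρ g (τ.1 (g⁻¹ * g)) = τ.1 g := congrArg (fun F : C(G, X) => F g) (τ.2 g)
    rw [inv_mul_cancel] at h2
    rw [h2, h1'']
  · rintro ⟨v, hv⟩
    have hval : ∀ y, (φ.1 + ContinuousMap.const G v) y = X.ρ y v := fun y => by
      simp [hv y]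
    have hmem : φ.1 + ContinuousMap.const G v ∈ (resolutionX X 1).ρ.invariants := by
      rw [ContRepresentation.mem_invariants]
      intro g
      ext x
      rw [coind₁_apply_apply, hval, hval, ← _root_.mul_apply_eq_comp, ← map_mul,
        mul_inv_cancel_left]
    refine ⟨⟨φ.1 + ContinuousMap.const G v, hmem⟩, Subtype.ext ?_⟩
    have h0 := homogeneousCochains.d_apply X 0 ⟨φ.1 + ContinuousMap.const G v, hmem⟩
    refine h0.trans ?_
    ext x y
    change (φ.1 + ContinuousMap.const G v) y - (φ.1 + ContinuousMap.const G v) x = φ.1 y - φ.1 x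
    simp

variable {H : Type v} [Group H] [TopologicalSpace H] [IsTopologicalGroup H] {Y : TopRep.{v} R H}

variable {X} in
/-- Pulling back a continuous crossed homomorphism along a compatible pair `(θ : H → G, f : X → Y)`:
`h ↦ f (φ (θ h))`. Serre, *Galois Cohomology*, I.§2.4. [folklore] -/
def contOneCocycles.pullback (θ : H →ₜ* G) (f : res (θ : H →* G) X ⟶ Y)
    (φ : contOneCocycles X) : contOneCocycles Y :=
  ⟨(f.hom : C(X, Y)).comp (φ.1.comp (θ : C(H, G))), fun g h => by
    change f.hom (φ.1 (θ (g * h))) = f.hom (φ.1 (θ g)) + Y.ρ g (f.hom (φ.1 (θ h)))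
    rw [map_mul, φ.2 (θ g) (θ h), map_add]
    congr 1
    exact TopRep.hom_comm_apply f g _⟩

omit [IsTopologicalGroup G] [IsTopologicalGroup H] in
/-- Unfolding `contOneCocycles.pullback`. [folklore] -/
@[simp]
theorem contOneCocycles.pullback_apply (θ : H →ₜ* G) (f : res (θ : H →* G) X ⟶ Y)
    (φ : contOneCocycles X) (h : H) :
    (contOneCocycles.pullback θ f φ).1 h = f.hom (φ.1 (θ h)) :=
  rfl

/-- Functoriality of `H¹` on explicit cocycles: Mathlib's `ContinuousCohomology.map θ f 1` sends
`[φ]` to `[f ∘ φ ∘ θ]`. Serre, *Galois Cohomology*, I.§2.4. [folklore] -/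
theorem map_oneCocycleClass (θ : H →ₜ* G) (f : res (θ : H →* G) X ⟶ Y)
    (φ : contOneCocycles X) :
    ContinuousCohomology.map θ f 1 (oneCocycleClass X φ) =
      oneCocycleClass Y (contOneCocycles.pullback θ f φ) := by
  unfold oneCocycleClass ContinuousCohomology.map
  refine homologyMap_cxClass _ 1 2 up_nat_next_one _ _ _ _ (Subtype.ext ?_)
  ext x y
  change f.hom (φ.1 (θ y)) - f.hom (φ.1 (θ x)) = f.hom (φ.1 (θ y) - φ.1 (θ x))
  rw [map_sub]

end H1

end Literature.NumberTheory.GaloisRepresentations
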